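import Summits.KontsevichZagierPeriods.KontsevichZagierPeriods.Theses.HurwitzMicroSectors
import Summits.KontsevichZagierPeriods.KontsevichZagierPeriods.Theorems.SectorTwoSix.Negative.LoadBearing
import Summits.KontsevichZagierPeriods.KontsevichZagierPeriods.Theorems.HurwitzMicroSectorsSectorTwoSixStubDilationTwo
import Summits.KontsevichZagierPeriods.KontsevichZagierPeriods.Theorems.HurwitzMicroSectorsSectorTwoSixStubTargets
import Summits.KontsevichZagierPeriods.KontsevichZagierPeriods.Theorems.HurwitzMicroSectorsSectorTwoSixStubReduce
import Summits.KontsevichZagierPeriods.KontsevichZagierPeriods.Theorems.HurwitzMicroSectorsSectorTwoSixStubNfValue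
import Summits.KontsevichZagierPeriods.KontsevichZagierPeriods.Theorems.HurwitzMicroSectorsSectorTwoSixStubRigid
import Literature.NumberTheory.Transcendental.KZLogCalculusProofs

/-!
# `SectorTwoSix` (stmt-KontsevichZagierPeriods-3870, route HurwitzMicroSectors) — line
`jacobian-monomial-absorption`: the crux, PROVED

Crux (rank 2): under Calegari–Dimitrov–Tang's Theorem 1 (`1, π², L(2,χ₋₃)` are `ℚ`-linearly
independent — the named fact `calegariDimitrovTang_linearIndependent`, the crux's own antecedent,
never proved here), two integral representations on the open box `(0,1)²` with integrands
`P(x₀x₁)/(1−(x₀x₁)⁶)`, `P'(x₀x₁)/(1−(x₀x₁)⁶)` (`P, P' ∈ ℚ[t]`) and equal values are KZ-equivalent: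
Conjecture 1 of Kontsevich–Zagier on the level-6 weight-2 box sector.

Line (lever): every relation of the reduction is ONE change of variables along the diagonal power
map `Φₘ(x) = (x₀ᵐ, x₁ᵐ)` of the open box (Jacobian `m² tᵐ⁻¹`, `t = x₀x₁`): the level-6 distribution
relations (`m = 2, 3`) AND the monomial evaluations `[box, tᵏ] ∼ [box, (k+1)⁻²]` (`m = k+1`,
constant target integrand) — no Newton–Leibniz move, no change of dimension, one domain throughout.
This file is the registered skeleton of the line with its five stubs discharged by the landed files
* `…StubDilationTwo` — the engine (`n = 2` dilation move, tree `BoxCoordinatePowerMap`);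
* `…StubTargets` — the single-move targets on the canonical representations `sectorRep P`;
* `…StubReduce` — reduction of every numerator to a normal form `a(1−t⁶) + bt³ + ct⁵` (rule 1b +
  the scaling endomorphism `KZ.scale`: rational rescaling inside integrands, no division rule);
* `…StubNfValue` — the value `a + bH₃ + cH₅`, `H₃ = −L(2,χ₋₃)/8 + π²/54`, `H₅ = π²/216`;
* `…StubRigid` — coefficient comparison under CDT;
composed in `SectorTwoSix_of`. The canonical representations are the landed
`Theorems/SectorTwoSix/Negative/LoadBearing.sectorRep`; nothing is defined here, no fact beyond the
crux's antecedent is used (which enters exactly once, at the coefficient comparison, together with the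
value hypothesis — cf. the landed `Negative/LoadBearing`: the value hypothesis is load-bearing, rule (1)
alone does not suffice, and the pair `[1+t³] ∼ [4t]` is one `m = 2` dilation).

References: M. Kontsevich, D. Zagier, *Periods* (2001), §1.2 rules (1), (2); F. Calegari,
V. Dimitrov, Y. Tang, *The linear independence of 1, ζ(2) and L(2,χ₋₃)*, arXiv:2408.15403 (2024),
Thm. 1; J. Milnor, Enseign. Math. 29 (1983) §1 and S. Lang, *Cyclotomic Fields I–II* (1990) Ch. 2
§8–10 (distribution relations).
-/

noncomputable section

open Set MeasureTheory Polynomial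
open Literature.NumberTheory.Transcendental
open Summit.KontsevichZagierPeriods.Theorems.SectorTwoSix.Negative

namespace Summit.KontsevichZagierPeriods.Theorems.HurwitzMicroSectorsSectorTwoSix

open Summit.KontsevichZagierPeriods.KontsevichZagierPeriods.Theses.HurwitzMicroSectors (SectorTwoSix)

/-- **Crux `SectorTwoSix` (stmt-KontsevichZagierPeriods-3870), PROVED.** Given CDT and two sector
representations `r, r'` with equal values: replace them by the canonical `sectorRep P`,
`sectorRep P'` (off-domain freedom is a rule-1b relation, `KZ.of_sub_of_mem_relations_of_eqOn`),
reduce both numerators to normal forms (`stub_reduce` fed by `stub_targets` fed by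
`stub_dilationTwo`), read the values (`stub_nfValue`, soundness `KZ.Equivalent.value_eq_holds`),
compare coefficients (`stub_rigid`, the only use of CDT and of the value hypothesis), and compose the
chain `r ∼ [P] ∼ [nf] = [nf'] ∼ [P'] ∼ r'`. [Kontsevich–Zagier 2001, §1.2; Calegari–Dimitrov–Tang 2024, Thm. 1] -/
theorem SectorTwoSix_of : SectorTwoSix := by
  intro hCDT r r' P P' hd hd' hf hf' hv
  obtain ⟨hM, h2, h3⟩ := stub_targets stub_dilationTwo
  obtain ⟨a, b, c, hP⟩ := stub_reduce hM h2 h3 P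
  obtain ⟨a', b', c', hP'⟩ := stub_reduce hM h2 h3 P'
  have h1 : KZ.of r - KZ.of (sectorRep P) ∈ KZ.relations :=
    KZ.of_sub_of_mem_relations_of_eqOn (by rw [sectorRep_domain, hd]; rfl) fun x hx => hf hx
  have h1' : KZ.of r' - KZ.of (sectorRep P') ∈ KZ.relations :=
    KZ.of_sub_of_mem_relations_of_eqOn (by rw [sectorRep_domain, hd']; rfl) fun x hx => hf' hx
  have hvr : r.value = (sectorRep (C a * (1 - X ^ 6) + C b * X ^ 3 + C c * X ^ 5)).value :=
    (KZ.Equivalent.value_eq_holds h1).trans (KZ.Equivalent.value_eq_holds hP)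
  have hvr' : r'.value = (sectorRep (C a' * (1 - X ^ 6) + C b' * X ^ 3 + C c' * X ^ 5)).value :=
    (KZ.Equivalent.value_eq_holds h1').trans (KZ.Equivalent.value_eq_holds hP')
  rw [stub_nfValue] at hvr hvr'
  obtain ⟨rfl, rfl, rfl⟩ := stub_rigid hCDT a b c a' b' c' (by rw [← hvr, ← hvr', hv])
  have : KZ.of r - KZ.of r' = (KZ.of r - KZ.of (sectorRep P)) +
      (KZ.of (sectorRep P) - KZ.of (sectorRep (C a * (1 - X ^ 6) + C b * X ^ 3 + C c * X ^ 5))) -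
      (KZ.of (sectorRep P') - KZ.of (sectorRep (C a * (1 - X ^ 6) + C b * X ^ 3 + C c * X ^ 5))) -
      (KZ.of r' - KZ.of (sectorRep P')) := by abel
  show KZ.of r - KZ.of r' ∈ KZ.relations
  rw [this]
  exact KZ.relations.sub_mem (KZ.relations.sub_mem (KZ.relations.add_mem h1 hP) hP') h1'

end Summit.KontsevichZagierPeriods.Theorems.HurwitzMicroSectorsSectorTwoSix

end
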